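import Literature.Analysis.FunctionSpaces.TorusFractionalSobolevEmbedding
import Literature.Analysis.FunctionSpaces.TorusSobolevNormEmbeddingProofs
import Literature.Analysis.FunctionSpaces.TorusSobolevNormFacts
import Literature.Analysis.FunctionSpaces.TorusVectorParseval
import Literature.Analysis.FunctionSpaces.TorusFourierCalculus
import Literature.Analysis.FunctionSpaces.LatticeSobolev
import Literature.Analysis.FluidPDE.CriticalSpacesProofs
import HarnessLib

/-!
# The Sobolev embedding `H¹(T³) ⊂ L⁶(T³)` for spectral `H¹` fields

The tree holds `H¹ ⊂ L⁶` on the three-torus for SMOOTH fields with the classical gradient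
(`Torus.lintegral_enorm_pow_six_le_cube_of_isSmooth`, `TorusSobolevL6`) and the fractional Sobolev
inequality for mean-zero `L²` fields with summable spectral weights
(`Torus.exists_lintegral_rpow_norm_le_hsSeminorm`, `TorusFractionalSobolevEmbedding`). This file records
the form consumed by statements typed over the spectral scale `Torus.MemSobolev` / `Torus.eSobolevNorm`
(e.g. `C([0,T];H¹) ⊂ C([0,T];L⁶)` steps of claimed proofs): for every real vector field `v` on `T^d`,
`card d = 3`, with `complexify ∘ v ∈ H¹`,

`v ∈ L⁶` and `‖v‖_{L⁶} ≤ K ‖complexify ∘ v‖_{H¹}`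

with `K` depending only on `d` (Robinson–Rodrigo–Sadowski 2016, Thm 1.19 with `s = 1`, `n = 3`, plus
the mean: `‖v‖₆ ≤ ‖v − v̄‖₆ + |v̄|`, `|v̄| ≤ ‖v‖₂ ≤ ‖v‖_{H¹}`). Proof: split off the mean, apply the tree's
mean-zero inequality to `v − v̄` (its weighted spectral sum `∑ |k|²|v̂(k)|²` is that of `v` and is bounded
by `‖v‖²_{H¹}`), and Parseval for the mean.

## References
* J. C. Robinson, J. L. Rodrigo, W. Sadowski, *The three-dimensional Navier–Stokes equations*, CUP
  2016, Thm 1.19 (fractional Sobolev embedding on `𝕋³`). [RobinsonRodrigoSadowskiCUP2016]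
* L. C. Evans, *Partial Differential Equations*, 2nd ed., AMS 2010, §5.6.1 Thm 1 / §5.6.3
  (Gagliardo–Nirenberg–Sobolev, `p* = 6` for `n = 3`, `p = 2`). [Evans2010]
-/

noncomputable section

open MeasureTheory Set Filter UnitAddTorus
open scoped ENNReal NNReal Topology

namespace Literature.Analysis.FunctionSpaces

namespace Torus

variable {d : Type*} [Fintype d] [DecidableEq d]

omit [DecidableEq d] in
/-- The square of the spectral `H^s` norm is the weighted sum of the squared Fourier coefficients.
[folklore] -/
private theorem eSobolevNorm_sq_eq_tsum {F : Type*} [NormedAddCommGroup F] [NormedSpace ℂ F] (s : ℝ)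
    (f : UnitAddTorus d → F) :
    eSobolevNorm s f ^ 2 =
      ∑' k : d → ℤ, ENNReal.ofReal (sobolevWeight s k ^ 2) * ‖mFourierCoeff f k‖ₑ ^ 2 := by
  rw [eSobolevNorm, ← ENNReal.rpow_natCast, ← ENNReal.rpow_mul]
  norm_num

omit [DecidableEq d] in
/-- Fourier coefficients of a constant vector field vanish off the zero mode. [folklore] -/
private theorem mFourierCoeff_const_of_ne_zero {F : Type*} [NormedAddCommGroup F] [NormedSpace ℂ F]
    [CompleteSpace F] (c : F) {k : d → ℤ} (hk : k ≠ 0) :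
    mFourierCoeff (fun _ : UnitAddTorus d => c) k = 0 := by
  rw [mFourierCoeff_eq_integral_volume, integral_smul_const, integral_mFourier]
  simp [hk]

omit [DecidableEq d] in
/-- Subtracting a constant does not change the `|k|²`-weighted spectral sum of a real vector field
(the weight kills the zero mode, the only coefficient that changes). [folklore] -/
private theorem freqNormSq_mul_norm_mFourierCoeff_sub_const_sq {v : UnitAddTorus d → EuclideanSpace ℝ d}
    (hv : Integrable v volume) (m : EuclideanSpace ℝ d) (k : d → ℤ) :
    freqNormSq k ^ (1 : ℝ) * ‖mFourierCoeff (EuclideanSpace.complexify ∘ fun x => v x - m) k‖ ^ 2 =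
      freqNormSq k ^ (1 : ℝ) * ‖mFourierCoeff (EuclideanSpace.complexify ∘ v) k‖ ^ 2 := by
  by_cases hk : k = 0
  · subst hk
    simp [freqNormSq_zero]
  · congr 2
    have hsplit : (EuclideanSpace.complexify ∘ fun x => v x - m) =
        (EuclideanSpace.complexify ∘ v) + fun _ => -EuclideanSpace.complexify m := by
      funext x
      simp [sub_eq_add_neg]
    rw [hsplit, mFourierCoeff_add (integrable_complexify_comp hv) (integrable_const _),
      mFourierCoeff_const_of_ne_zero _ hk, add_zero]

/-- **`H¹(T³) ⊂ L⁶(T³)`, spectral form** (Robinson–Rodrigo–Sadowski 2016, Thm 1.19, `s = 1`, `n = 3`;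
Evans 2010, §5.6.1 Thm 1): on `T^d` with `card d = 3` there is `K` such that every real vector field `v`
with `complexify ∘ v ∈ H¹` lies in `L⁶` with `‖v‖_{L⁶} ≤ K ‖complexify ∘ v‖_{H¹}`.
[cite: RobinsonRodrigoSadowskiCUP2016, Theorem 1.19] -/
theorem exists_eLpNorm_six_le_eSobolevNorm_one (hd : Fintype.card d = 3) :
    ∃ K : ℝ≥0, ∀ v : UnitAddTorus d → EuclideanSpace ℝ d,
      MemSobolev 1 (EuclideanSpace.complexify ∘ v) →
        MemLp v 6 volume ∧
          eLpNorm v 6 volume ≤ K * eSobolevNorm 1 (EuclideanSpace.complexify ∘ v) := by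
  obtain ⟨C, hC0, hC⟩ := exists_lintegral_rpow_norm_le_hsSeminorm (d := d) (s := 1) one_pos
    (by rw [hd]; norm_num)
  have hq : 2 * (Fintype.card d : ℝ) / ((Fintype.card d : ℝ) - 2 * 1) = 6 := by rw [hd]; norm_num
  have hr : (Fintype.card d : ℝ) / ((Fintype.card d : ℝ) - 2 * 1) = 3 := by rw [hd]; norm_num
  rw [hq, hr] at hC
  refine ⟨(C ^ (1 / 6 : ℝ)).toNNReal + 1, fun v hv => ?_⟩
  -- `L²` bookkeeping
  set cv : UnitAddTorus d → EuclideanSpace ℂ d := EuclideanSpace.complexify ∘ v with hcv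
  have hv2c : MemLp cv 2 volume := MemSobolev.memLp_two_holds hv zero_le_one
  have hv2 : MemLp v 2 volume := FluidPDE.memLp_complexify_comp_iff.1 hv2c
  have hvi : Integrable v volume := hv2.integrable one_le_two
  set H : ℝ≥0∞ := eSobolevNorm 1 cv with hH
  -- the mean and the mean-free part
  set m : EuclideanSpace ℝ d := ∫ x, v x with hm
  set w : UnitAddTorus d → EuclideanSpace ℝ d := fun x => v x - m with hw
  have hw2 : MemLp w 2 volume := hv2.sub (memLp_const m)
  have hw0 : HasZeroMean w := by
    unfold HasZeroMean
    rw [hw, integral_sub hvi (integrable_const _), integral_const]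
    simp [hm]
  -- the weighted spectral sum of `w` is that of `v`, and it is bounded by `‖v‖²_{H¹}`
  set S : ℝ := ∑' k : d → ℤ, freqNormSq k ^ (1 : ℝ) * ‖mFourierCoeff cv k‖ ^ 2 with hS
  have hterm_nonneg : ∀ k : d → ℤ, 0 ≤ freqNormSq k ^ (1 : ℝ) * ‖mFourierCoeff cv k‖ ^ 2 := fun k =>
    mul_nonneg (Real.rpow_nonneg (freqNormSq_nonneg k) _) (sq_nonneg _)
  have hterm_le : ∀ k : d → ℤ, freqNormSq k ^ (1 : ℝ) * ‖mFourierCoeff cv k‖ ^ 2 ≤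
      sobolevWeight 1 k ^ 2 * ‖mFourierCoeff cv k‖ ^ 2 := fun k => by
    rw [Real.rpow_one, sobolevWeight_one_sq]
    exact mul_le_mul_of_nonneg_right (by linarith) (sq_nonneg _)
  have hsumv : Summable fun k : d → ℤ => freqNormSq k ^ (1 : ℝ) * ‖mFourierCoeff cv k‖ ^ 2 :=
    (hv.summable_sobolevWeight_sq_mul_norm_sq).of_nonneg_of_le hterm_nonneg hterm_le
  have hcoef : (fun k : d → ℤ =>
      freqNormSq k ^ (1 : ℝ) * ‖mFourierCoeff (EuclideanSpace.complexify ∘ w) k‖ ^ 2) =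
      fun k => freqNormSq k ^ (1 : ℝ) * ‖mFourierCoeff cv k‖ ^ 2 := by
    funext k
    exact freqNormSq_mul_norm_mFourierCoeff_sub_const_sq hvi m k
  have hsumw : Summable fun k : d → ℤ =>
      freqNormSq k ^ (1 : ℝ) * ‖mFourierCoeff (EuclideanSpace.complexify ∘ w) k‖ ^ 2 := by
    rw [hcoef]; exact hsumv
  have hS0 : 0 ≤ S := tsum_nonneg hterm_nonneg
  have hSH : ENNReal.ofReal S ≤ H ^ 2 := by
    rw [hH, eSobolevNorm_sq_eq_tsum, hS, ENNReal.ofReal_tsum_of_nonneg hterm_nonneg hsumv]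
    refine ENNReal.tsum_le_tsum fun k => ?_
    rw [ENNReal.ofReal_mul (Real.rpow_nonneg (freqNormSq_nonneg k) _), ← ofReal_norm,
      ← ENNReal.ofReal_pow (norm_nonneg _)]
    refine mul_le_mul_left (ENNReal.ofReal_le_ofReal ?_) _
    rw [Real.rpow_one, sobolevWeight_one_sq]
    linarith
  -- the fractional Sobolev inequality for the mean-free part
  have hemb := hC w hw2 hw0 hsumw
  rw [hcoef] at hemb
  have hlin : ∫⁻ x, ‖w x‖ₑ ^ (6 : ℝ) = ∫⁻ x, ENNReal.ofReal (‖w x‖ ^ (6 : ℝ)) := by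
    refine lintegral_congr fun x => ?_
    rw [← ofReal_norm, ENNReal.ofReal_rpow_of_nonneg (norm_nonneg _) (by norm_num)]
  have hw6 : eLpNorm w 6 volume ≤ ENNReal.ofReal (C ^ (1 / 6 : ℝ)) * H := by
    rw [eLpNorm_eq_lintegral_rpow_enorm_toReal (by norm_num) (by norm_num)]
    have h6 : (6 : ℝ≥0∞).toReal = 6 := by norm_num
    rw [h6, hlin]
    calc (∫⁻ x, ENNReal.ofReal (‖w x‖ ^ (6 : ℝ))) ^ (1 / (6 : ℝ))
        ≤ (ENNReal.ofReal (C * S ^ (3 : ℝ))) ^ (1 / (6 : ℝ)) := by gcongr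
      _ = ENNReal.ofReal C ^ (1 / (6 : ℝ)) * (ENNReal.ofReal S ^ (3 : ℝ)) ^ (1 / (6 : ℝ)) := by
          rw [ENNReal.ofReal_mul hC0.le, ← ENNReal.ofReal_rpow_of_nonneg hS0 (by norm_num),
            ENNReal.mul_rpow_of_nonneg _ _ (by norm_num)]
      _ ≤ ENNReal.ofReal C ^ (1 / (6 : ℝ)) * ((H ^ 2) ^ (3 : ℝ)) ^ (1 / (6 : ℝ)) := by gcongr
      _ = ENNReal.ofReal (C ^ (1 / 6 : ℝ)) * H := by
          rw [ENNReal.ofReal_rpow_of_pos hC0, ← ENNReal.rpow_natCast, ← ENNReal.rpow_mul,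
            ← ENNReal.rpow_mul]
          norm_num
  -- the mean: `‖m‖ ≤ ‖v‖₂ ≤ ‖v‖_{H¹}`
  have hmH : (‖m‖ₑ : ℝ≥0∞) ≤ H := by
    calc (‖m‖ₑ : ℝ≥0∞) ≤ ∫⁻ x, ‖v x‖ₑ := by rw [hm]; exact enorm_integral_le_lintegral_enorm _
      _ = eLpNorm v 1 volume := by rw [eLpNorm_one_eq_lintegral_enorm]
      _ ≤ eLpNorm v 2 volume :=
          eLpNorm_le_eLpNorm_of_exponent_le (by norm_num) hv2.aestronglyMeasurable
      _ = eSobolevNorm 0 cv := (eSobolevNorm_zero_complexify hv2).symm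
      _ ≤ H := eSobolevNorm_mono zero_le_one cv
  have hconst6 : eLpNorm (fun _ : UnitAddTorus d => m) 6 volume = ‖m‖ₑ := by
    rw [eLpNorm_const m (by norm_num) (NeZero.ne _), measure_univ, ENNReal.one_rpow, mul_one]
  -- assemble
  have hvsplit : v = w + fun _ => m := by funext x; simp [hw]
  have hbound : eLpNorm v 6 volume ≤ ↑((C ^ (1 / 6 : ℝ)).toNNReal + 1) * H := by
    calc eLpNorm v 6 volume = eLpNorm (w + fun _ => m) 6 volume := by rw [← hvsplit]
      _ ≤ eLpNorm w 6 volume + eLpNorm (fun _ : UnitAddTorus d => m) 6 volume :=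
          eLpNorm_add_le hw2.aestronglyMeasurable aestronglyMeasurable_const (by norm_num)
      _ ≤ ENNReal.ofReal (C ^ (1 / 6 : ℝ)) * H + H := by rw [hconst6]; exact add_le_add hw6 hmH
      _ = ↑((C ^ (1 / 6 : ℝ)).toNNReal + 1) * H := by
          rw [ENNReal.coe_add, ENNReal.coe_one, add_mul, one_mul, ENNReal.ofReal]
  refine ⟨⟨hv2.aestronglyMeasurable, lt_of_le_of_lt hbound ?_⟩, hbound⟩
  exact ENNReal.mul_lt_top ENNReal.coe_lt_top hv.eSobolevNorm_lt_top

end Torus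

end Literature.Analysis.FunctionSpaces
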